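import Summits.PneNP.PneNP.Theorems.SymmetryBudgetWindowCanoniserSemMain1

/-!
# Window canoniser, XIX: gate semantics of the main computation — lifting and choice

Route `PneNP/SymmetryBudget`, dichotomy `WindowBarrier` (stmt-PneNP-2145) / `NoHiddenOrder` (stmt-PneNP-14781);
continuation of `…WindowCanoniserSemMain1.lean`.  The certification gate through the child builders
(`WCan.ev_aCert_inl`, `WCan.ev_aCert_inr`); a candidate's colour ranks re-expressed in my colouring
(`pcand`, `lcrk`); the lifted value vector `WCan.lvec κ i = ev (lbitA κ i)`; prefix agreement `pfx`, the
lexicographic comparison `lexLE ↔ toLex (lvec κ) ≤ toLex (lvec κ')`, `best ↔ WCan.bestP` (certified and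
lexicographically least among the certified candidates), the value bits `ivbit` at an individualisation node and
`inonbot` (some candidate is certified).
-/

-- `Summit.PneNP.PneNP.…` duplicates `PneNP` BY DESIGN (single-problem summit, D-0017 layout).
set_option linter.dupNamespace false

noncomputable section

namespace Summit.PneNP.PneNP.Theorems

namespace WCan

open Finset Literature.Computability.Complexity Literature.Computability.Complexity.CGCanon
  Literature.Combinatorics.SimpleGraph
open scoped Classical

variable {K r n : ℕ}

section MathSide

variable [NeZero n] (L : Lab K n) (x : Fin (r + n) × Fin (r + n) → Bool)

/-- The LIFTED VALUE VECTOR of the candidate `κ`: the values of the atoms `lbitA κ i`. -/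
def lvec (κ : Fin n × Fin (n + 1)) : Fin (NB r n) → Bool := fun i => ev x (lbitA L κ i)

/-- The candidate `κ` is CERTIFIED (its `cert` gate fires). -/
def certP (κ : Fin n × Fin (n + 1)) : Prop := ev x (aCert (r := r) L (Sum.inl κ) κ.1) = true

/-- The candidate `κ` is BEST: certified, and its lifted vector is lexicographically least among the certified. -/
def bestP (κ : Fin n × Fin (n + 1)) : Prop :=
  certP (r := r) L x κ ∧ ∀ κ', certP (r := r) L x κ' → toLex (lvec (r := r) L x κ) ≤ toLex (lvec L x κ')

end MathSide

variable [NeZero n] {L : Lab K n} {x : Fin (r + n) × Fin (r + n) → Bool} (hn : 2 ≤ n)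
include hn

/-! ### Certification through the builders -/

omit hn in
/-- The ambient vertex of a candidate's certification atom is immaterial. -/
theorem aCert_inl_eq (κ : Fin n × Fin (n + 1)) (z : Fin n) : aCert (r := r) L (Sum.inl κ) z = aCert L (Sum.inl κ) κ.1 := rfl

omit hn in
/-- The child slots of a candidate record. -/
theorem chLab_prmCh_inl (κ : Fin n × Fin (n + 1)) (z : Fin n) (it : Fin (T n + 1)) :
    chLab L (prmCh (r := r) (Sum.inl κ) z it) = candLab L κ.1 κ.2 := by
  obtain ⟨a, h⟩ := κ; rfl

omit hn in
/-- The child slots of a part record. -/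
theorem chLab_prmCh_inr (U' : Finset (Fin n)) (z : Fin n) (it : Fin (T n + 1)) :
    chLab L (prmCh (r := r) (Sum.inr U') z it) = partLab L U' := rfl

/-- `cert` of a candidate child. -/
theorem ev_aCert_inl (κ : Fin n × Fin (n + 1)) (z : Fin n) : ev x (aCert L (Sum.inl κ) z) =
    decide (∃ Lc, candLab L κ.1 κ.2 = some Lc ∧ thruR L.1 Lc.1 x false κ.1 ∧ okP Lc.1 x ∧ NBP (r := r) Lc x κ.1) := by
  obtain ⟨a, h⟩ := κ
  rw [aCert, ev_cert hn]; rfl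

/-- `cert` of a part child. -/
theorem ev_aCert_inr (U' : Finset (Fin n)) (z : Fin n) : ev x (aCert L (Sum.inr U') z) =
    decide (∃ Lc, partLab L U' = some Lc ∧ thruR L.1 Lc.1 x true z ∧ okP Lc.1 x ∧ NBP (r := r) Lc x z) := by
  rw [aCert, ev_cert hn]; rfl

/-! ### Lifting a candidate's colour ranks -/

/-- `pcand κ p w`: the candidate's value says position `p` has (child) colour rank `j`, and `w ∈ W` has rank `j`
in the child's final colouring, for some `j`. -/
theorem ev_aPcand (κ : Fin n × Fin (n + 1)) (p w : Fin n) : ev x (aPcand L κ p w) =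
    decide (∃ Lc, candLab L κ.1 κ.2 = some Lc ∧ ∃ j : Fin n, ev x (aVbit (r := r) Lc κ.1 (benc (.crk p j))) = true ∧
      rankF Lc.1 x w = j ∧ w ∈ (finSt Lc.1 x).W) := by
  apply Bool.eq_iff_iff.2
  show Vl K x _ = true ↔ _
  rw [Vl_eq, decide_eq_true_iff]
  show (GateFn.or n).2 (fun i => GateDAG.wire x (Vl K x) (Kind.argsM L .pcand (prm (vec2 κ.1 w) (h1 := κ.2) (ns := nvec1 p)) i)) =
    true ↔ _
  simp only [GateFn.or, decide_eq_true_iff, Kind.argsM, prm_vs, prm_h1, prm_ns, vec2_0, vec2_1, nvec1_apply]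
  rcases hc : candLab L κ.1 κ.2 with _ | Lc
  · simp
  · simp only [wire_w2, Option.some.injEq, exists_eq_left']
    refine exists_congr fun j => ?_
    rw [Vl_n2and x _ (by simp)]
    simp [Vl_litN1, Vl_rkF hn, (corr_fin (L := Lc) (x := x) hn).W]

/-- `lcrk κ p j`: position `p` of the candidate's value has colour rank `j` IN MY final colouring. -/
theorem ev_aLcrk (κ : Fin n × Fin (n + 1)) (p j : Fin n) : ev x (aLcrk L κ p j) =
    decide (∃ w, ev x (aPcand (r := r) L κ p w) = true ∧ rankF L.1 x w = j) := by
  apply Bool.eq_iff_iff.2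
  show Vl K x _ = true ↔ _
  rw [Vl_eq, decide_eq_true_iff]
  show (GateFn.or n).2 (fun i => GateDAG.wire x (Vl K x) (Kind.argsM L .lcrk (prm (vec1 κ.1) (h1 := κ.2) (ns := nvec2 p j)) i)) =
    true ↔ _
  simp only [GateFn.or, decide_eq_true_iff, Kind.argsM, prm_vs, prm_h1, prm_ns, vec1_apply, nvec2_0, nvec2_1, wire_w2]
  refine exists_congr fun w => ?_
  rw [Vl_n2and x _ (by simp)]
  simp [Vl_litN1, Vl_rkF hn]

/-! ### Prefix agreement and lexicographic comparison -/

omit hn in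
/-- `pfx κ κ' t`: the lifted vectors agree below `t`. -/
theorem ev_aPfx (κ κ' : Fin n × Fin (n + 1)) (t : Fin (NB r n + 1)) : ev x (aPfx L κ κ' t) =
    decide (∀ i : Fin (NB r n), (i : ℕ) < t → lvec L x κ i = lvec L x κ' i) := by
  apply Bool.eq_iff_iff.2
  show Vl K x _ = true ↔ _
  rw [Vl_eq, decide_eq_true_iff]
  show (GateFn.and (NB r n)).2 (fun i => GateDAG.wire x (Vl K x)
    (Kind.argsM L .pfx (prm (vec2 κ.1 κ'.1) (h1 := κ.2) (h2 := κ'.2) (b := t)) i)) = true ↔ _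
  simp only [GateFn.and, decide_eq_true_iff, Kind.argsM, prm_vs, prm_h1, prm_h2, prm_b, vec2_0, vec2_1]
  refine forall_congr' fun i => ?_
  split_ifs with h
  · simp only [wire_w2, Vl_iffF, h, forall_true_left, lvec]
    constructor
    · intro h'; exact Bool.eq_iff_iff.2 h'
    · intro h'; rw [h']
  · simp [h]

omit hn in
/-- Strict lexicographic order of Boolean tuples, unfolded. -/
theorem toLex_lt_iff {N : ℕ} (f g : Fin N → Bool) : toLex f < toLex g ↔ ∃ i, (∀ j < i, f j = g j) ∧ f i = false ∧ g i = true := by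
  refine exists_congr fun i => and_congr Iff.rfl ?_
  constructor
  · intro h; exact Bool.lt_iff.1 h
  · rintro ⟨h1, h2⟩; exact Bool.lt_iff.2 ⟨h1, h2⟩

omit hn in
/-- `lexLE κ κ'`: the lifted vector of `κ` is lexicographically at most that of `κ'`. -/
theorem ev_aLexLE (κ κ' : Fin n × Fin (n + 1)) : ev x (aLexLE L κ κ') = decide (toLex (lvec L x κ) ≤ toLex (lvec (r := r) L x κ')) := by
  apply Bool.eq_iff_iff.2
  show Vl K x _ = true ↔ _
  rw [Vl_eq, decide_eq_true_iff]
  show (GateFn.or (NB r n + 1)).2 (fun i => GateDAG.wire x (Vl K x)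
    (Kind.argsM L .lexLE (prm (vec2 κ.1 κ'.1) (h1 := κ.2) (h2 := κ'.2)) i)) = true ↔ _
  simp only [GateFn.or, decide_eq_true_iff, Kind.argsM, prm_vs, prm_h1, prm_h2, vec2_0, vec2_1]
  rw [le_iff_lt_or_eq, toLex_lt_iff, Fin.exists_fin_succ']
  simp only [Fin.val_castSucc, Fin.is_lt, ↓reduceDIte, Fin.eta, wire_w1, Fin.val_last, lt_self_iff_false, wire_wA,
    ev_aPfx, decide_eq_true_eq]
  apply or_congr
  · refine exists_congr fun i => ?_
    rw [Vl_n1and x _ (by simp)]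
    simp only [List.mem_cons, List.not_mem_nil, or_false, forall_eq_or_imp, forall_eq, holds_pos, holds_neg, ev_aPfx,
      decide_eq_true_eq, lvec]
    constructor
    · rintro ⟨h1, h2, h3⟩; exact ⟨fun j hj => h1 j hj, h2, h3⟩
    · rintro ⟨h1, h2, h3⟩; exact ⟨fun j hj => h1 j hj, h2, h3⟩
  · constructor
    · intro h; exact toLex_inj.2 (funext fun i => h i trivial)
    · intro h i _; rw [toLex_inj.1 h]

/-! ### Choice -/

omit hn in
/-- `best κ`: certified, and least among the certified candidates. -/
theorem ev_aBest (κ : Fin n × Fin (n + 1)) : ev x (aBest L κ) = decide (bestP (r := r) L x κ) := by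
  apply Bool.eq_iff_iff.2
  show Vl K x _ = true ↔ _
  rw [Vl_eq, decide_eq_true_iff]
  show (GateFn.and (n * (n + 1) + 1)).2 (fun i => GateDAG.wire x (Vl K x)
    (Kind.argsM L .best (prm (vec1 κ.1) (h1 := κ.2)) i)) = true ↔ _
  simp only [GateFn.and, decide_eq_true_iff, Kind.argsM, prm_vs, prm_h1, vec1_apply, Prod.mk.eta]
  rw [Fin.forall_fin_add]
  simp only [Fin.append_left, wire_w1, Fin.append_right, wire_wA, Fin.forall_fin_one, bestP, certP]
  rw [and_comm]
  refine and_congr Iff.rfl ?_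
  constructor
  · intro h κ' hc
    have := h (finProdFinEquiv κ')
    rw [Vl_n1or x _ (by simp)] at this
    simp only [List.mem_cons, List.not_mem_nil, or_false, exists_eq_or_imp, exists_eq_left, holds_neg, holds_pos,
      Equiv.symm_apply_apply, ev_aLexLE, decide_eq_true_eq] at this
    rcases this with h' | h'
    · rw [aCert_inl_eq] at h'; rw [h'] at hc; exact absurd hc Bool.false_ne_true
    · exact h'
  · intro h i
    rw [Vl_n1or x _ (by simp)]
    simp only [List.mem_cons, List.not_mem_nil, or_false, exists_eq_or_imp, exists_eq_left, holds_neg, holds_pos,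
      ev_aLexLE, decide_eq_true_eq]
    by_cases hc : ev x (aCert L (Sum.inl (finProdFinEquiv.symm i)) (finProdFinEquiv.symm i).1) = true
    · exact Or.inr (h _ hc)
    · left; rw [aCert_inl_eq]; simpa using hc

omit hn in
/-- `ivbit b`: bit `b` of the lifted vector of a best candidate. -/
theorem ev_aIvbit (z : Fin n) (b : Fin (NB r n)) : ev x (aIvbit L z b) = decide (∃ κ, bestP (r := r) L x κ ∧ lvec L x κ b = true) := by
  apply Bool.eq_iff_iff.2
  show Vl K x _ = true ↔ _
  rw [Vl_eq, decide_eq_true_iff]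
  show (GateFn.or (n * (n + 1))).2 (fun i => GateDAG.wire x (Vl K x)
    (Kind.argsM L .ivbit (prm (vec1 z) (b := b.castSucc)) i)) = true ↔ _
  simp only [GateFn.or, decide_eq_true_iff, Kind.argsM, prm_b, Fin.val_castSucc, Fin.is_lt, ↓reduceDIte, Fin.eta, wire_w1]
  constructor
  · rintro ⟨i, hi⟩
    rw [Vl_n1and x _ (by simp)] at hi
    simp only [List.mem_cons, List.not_mem_nil, or_false, forall_eq_or_imp, forall_eq, holds_pos, ev_aBest,
      decide_eq_true_eq] at hi
    exact ⟨_, hi.1, hi.2⟩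
  · rintro ⟨κ, hb, hl⟩
    refine ⟨finProdFinEquiv κ, ?_⟩
    rw [Vl_n1and x _ (by simp)]
    simp only [List.mem_cons, List.not_mem_nil, or_false, forall_eq_or_imp, forall_eq, holds_pos, ev_aBest,
      decide_eq_true_eq, Equiv.symm_apply_apply]
    exact ⟨hb, hl⟩

omit hn in
/-- `inonbot`: some candidate is certified. -/
theorem ev_aInonbot (z : Fin n) : ev x (aInonbot L z) = decide (∃ κ, certP (r := r) L x κ) := by
  apply Bool.eq_iff_iff.2
  show Vl K x _ = true ↔ _
  rw [Vl_eq, decide_eq_true_iff]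
  show (GateFn.or (n * (n + 1))).2 (fun i => GateDAG.wire x (Vl K x) (Kind.argsM L .inonbot (prm (vec1 z)) i)) = true ↔ _
  simp only [GateFn.or, decide_eq_true_iff, Kind.argsM, wire_wA, certP]
  constructor
  · rintro ⟨i, hi⟩; exact ⟨_, by rw [aCert_inl_eq] at hi; exact hi⟩
  · rintro ⟨κ, hκ⟩; exact ⟨finProdFinEquiv κ, by rw [aCert_inl_eq]; simpa using hκ⟩

end WCan

end Summit.PneNP.PneNP.Theorems

end
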